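import Mathlib.Analysis.InnerProductSpace.PiL2
import Literature.MathematicalPhysics.StatisticalMechanics.LennardJonesClusters
import HarnessLib

/-!
# `ChargedEnergyGap` (stmt-AtomisticToContinuum-14231), line `two-tolerance-sandwich`:
# restriction bookkeeping under the hard core (stub `stub_deficitSplit`)

For a `1/3`-separated configuration `y : Fin N → ℝ³` and an ARBITRARY index set `D`, the total
Lennard-Jones energy is at least half the ordered-pair sum over `D × D` minus an absolute constant
per site OUTSIDE `D`:
`E(y) ≥ ½ · ∑_{i ∈ D} ∑_{j ∈ D, j ≠ i} V_LJ(|yᵢ - yⱼ|) − B · (N − #D)` with `B = 3 · 30375 / 2`.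

Proof.  PARTIAL SITE SUMS are bounded below (`neg_le_sum_lennardJones`): for every site `i` and
every index set `T`, `∑_{k ∈ T} V_LJ(|yᵢ - y_k|) ≥ −30375 = −(1/6) · 250 · 3⁶`, by the attractive
tail `V_LJ(s) ≥ −s⁻⁶/6`, non-negativity of the dropped terms `|yᵢ - y_k|⁻⁶`, and the shell sum
`sum_inv_pow_six_le` with `r = 1/3` (the diagonal term, if present, is `V_LJ(0) = 0`).  Then write
twice the energy as the full double sum (`two_mul_interactionEnergy_eq_sum_sum`, diagonal
`V_LJ(0) = 0`) and split it along `D` and `Dᶜ` (`sum_sum_eq_add_compl`): the `D × D` block is the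
ordered-pair sum of the statement (`Finset.sum_erase`), and each of the three other blocks is a sum
over `Dᶜ` of partial site sums (after `Finset.sum_comm` and `dist_comm` for the `D × Dᶜ` block),
hence `≥ −30375 · #Dᶜ`, with `#Dᶜ = N − #D`.  All `[folklore]`.
-/

noncomputable section

open scoped BigOperators
open Literature.MathematicalPhysics.StatisticalMechanics

namespace Summit.AtomisticToContinuum.Crystallization.Theorems.TwoToleranceSandwichDeficitSplit

/-- **Partial site sums under the hard core.** In a `1/3`-separated configuration in `ℝ³`, for
every site `i` and every index set `T`, `∑_{k ∈ T} V_LJ(|yᵢ - y_k|) ≥ −30375`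
(`30375 = (1/6) · 250 · 3⁶`; the diagonal term, if `i ∈ T`, is `V_LJ(0) = 0`). [folklore] -/
theorem neg_le_sum_lennardJones {N : ℕ} (y : Fin N → EuclideanSpace ℝ (Fin 3))
    (hsep : ∀ i j : Fin N, i ≠ j → (1 / 3 : ℝ) ≤ dist (y i) (y j)) (i : Fin N)
    (T : Finset (Fin N)) :
    -(30375 : ℝ) ≤ ∑ k ∈ T, lennardJones (dist (y i) (y k)) := by
  have hS := sum_inv_pow_six_le y (by norm_num : (0 : ℝ) < 1 / 3) hsep i
  have h729 : (250 : ℝ) * (1 / 3 : ℝ)⁻¹ ^ 6 = 6 * 30375 := by norm_num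
  rw [h729] at hS
  have hdiag : lennardJones (dist (y i) (y i)) = 0 := by rw [dist_self, lennardJones_zero]
  rw [← Finset.sum_erase T hdiag]
  have hsub : T.erase i ⊆ Finset.univ.erase i := Finset.erase_subset_erase i (Finset.subset_univ T)
  have hterm : ∀ k ∈ T.erase i,
      -((1 / 6) * (dist (y i) (y k))⁻¹ ^ 6) ≤ lennardJones (dist (y i) (y k)) := by
    intro k hk
    have hki : k ≠ i := Finset.ne_of_mem_erase hk
    have hpos : 0 < dist (y i) (y k) := lt_of_lt_of_le (by norm_num) (hsep i k hki.symm)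
    exact neg_le_lennardJones_of_le hpos le_rfl
  have h1 : -((1 / 6) * ∑ k ∈ T.erase i, (dist (y i) (y k))⁻¹ ^ 6) ≤
      ∑ k ∈ T.erase i, lennardJones (dist (y i) (y k)) := by
    rw [Finset.mul_sum, ← Finset.sum_neg_distrib]
    exact Finset.sum_le_sum hterm
  have h2 : ∑ k ∈ T.erase i, (dist (y i) (y k))⁻¹ ^ 6 ≤
      ∑ k ∈ Finset.univ.erase i, (dist (y i) (y k))⁻¹ ^ 6 :=
    Finset.sum_le_sum_of_subset_of_nonneg hsub fun k _ _ => by positivity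
  linarith

/-- **Sums of partial site sums over an index set.** For every pair of index sets `S, T`,
`∑_{i ∈ S} ∑_{k ∈ T} V_LJ(|yᵢ - y_k|) ≥ −30375 · #S` in a `1/3`-separated configuration.
[folklore] -/
theorem neg_mul_card_le_sum_sum {N : ℕ} (y : Fin N → EuclideanSpace ℝ (Fin 3))
    (hsep : ∀ i j : Fin N, i ≠ j → (1 / 3 : ℝ) ≤ dist (y i) (y j))
    (S T : Finset (Fin N)) :
    -(30375 : ℝ) * (S.card : ℝ) ≤ ∑ i ∈ S, ∑ k ∈ T, lennardJones (dist (y i) (y k)) := by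
  have h := Finset.sum_le_sum fun i (_ : i ∈ S) => neg_le_sum_lennardJones y hsep i T
  rw [Finset.sum_const, nsmul_eq_mul] at h
  linarith

/-- **STUB E — RESTRICTION BOOKKEEPING** (`stub_deficitSplit` of the line
`two-tolerance-sandwich` for `PricedLinkCensus.ChargedEnergyGap`).  In a `1/3`-separated
configuration `y : Fin N → ℝ³`, for every index set `D`,
`½ · ∑_{i ∈ D} ∑_{j ∈ D ∖ {i}} V_LJ(|yᵢ - yⱼ|) − B · (N − #D) ≤ E(y)` with the absolute constant
`B = 3 · 30375 / 2`. [folklore] -/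
theorem stub_deficitSplit : ∃ B : ℝ, ∀ (N : ℕ) (y : Fin N → EuclideanSpace ℝ (Fin 3)), (∀ i j : Fin N, i ≠ j → (1 / 3 : ℝ) ≤ dist (y i) (y j)) → ∀ D : Finset (Fin N), (1 / 2 : ℝ) * (∑ i ∈ D, ∑ j ∈ D.erase i, Literature.MathematicalPhysics.StatisticalMechanics.lennardJones (dist (y i) (y j))) - B * ((N : ℝ) - (D.card : ℝ)) ≤ Literature.MathematicalPhysics.StatisticalMechanics.interactionEnergy Literature.MathematicalPhysics.StatisticalMechanics.lennardJones y := by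
  refine ⟨3 * 30375 / 2, fun N y hsep D => ?_⟩
  -- twice the energy as the full double sum, split along `D` and `Dᶜ`
  have h2 := two_mul_interactionEnergy_eq_sum_sum lennardJones lennardJones_zero y
  rw [sum_sum_eq_add_compl (fun i k => lennardJones (dist (y i) (y k))) D] at h2
  -- the `D × D` block is the ordered-pair sum (diagonal `V_LJ(0) = 0`)
  have hDD : ∑ i ∈ D, ∑ k ∈ D.erase i, lennardJones (dist (y i) (y k)) =
      ∑ i ∈ D, ∑ k ∈ D, lennardJones (dist (y i) (y k)) := by
    refine Finset.sum_congr rfl fun i _ => Finset.sum_erase D ?_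
    rw [dist_self, lennardJones_zero]
  -- the `D × Dᶜ` block, after swapping the sums
  have hswap : ∑ i ∈ D, ∑ k ∈ Dᶜ, lennardJones (dist (y i) (y k)) =
      ∑ k ∈ Dᶜ, ∑ i ∈ D, lennardJones (dist (y k) (y i)) := by
    rw [Finset.sum_comm]
    exact Finset.sum_congr rfl fun k _ => Finset.sum_congr rfl fun i _ => by rw [dist_comm]
  have hB1 := neg_mul_card_le_sum_sum y hsep Dᶜ Dᶜ
  have hB2 := neg_mul_card_le_sum_sum y hsep Dᶜ D
  -- `#Dᶜ = N - #D`
  have hcard : (D.card : ℝ) + ((Dᶜ).card : ℝ) = N := by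
    have h := Finset.card_add_card_compl D
    rw [Fintype.card_fin] at h
    exact_mod_cast h
  rw [hswap] at h2
  rw [hDD]
  linarith

end Summit.AtomisticToContinuum.Crystallization.Theorems.TwoToleranceSandwichDeficitSplit

end
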